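import Mathlib
import Literature.Computability.AlgebraicComplexity.NewtonPolygonTau

/-!
# Crux `WordPerSuperPoly` (stmt-ValiantsHypothesis-6626), line `Sketch` — degree bound for Newton vertices

Supports `Summit.ValiantsHypothesis.ValiantsHypothesis.Theses.ElementaryWordLength.WordPerSuperPoly`
(route `ElementaryWordLength`), line `Sketch` (card `newton-shadow-word-tau`), open stub S2
`stub_cancellationSubexp` (the lead's): it settles S2's ABSOLUTE form in the regime of
exponent-bounded words and thereby pins down where a counterexample to S2 must live.

* `DegreeBound.ncard_extremePoints_le_of_fst_le`: a plane set all of whose points have first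
  coordinate in `{0, 1, …, d}` has at most `2 (d + 1)` hull vertices (a vertical line carries at most
  two extreme points: a third one would lie in the open segment of the other two).
* `newtonVertexCount_le_degreeOf`: hence `#vert Newt(f) ≤ 2 (deg_X f + 1)` for every bivariate `f`.
* `DegreeBound.degreeOf_wordProd_le`: every entry of the matrix of a sparse bivariate word
  (letters `E_{ij}(c · X^a Y^b)`) has `X`-degree at most the sum of the `a`-exponents of its letters.
* `newtonVertexCount_wordProd_le_of_exponents_le`: so a word of length `L` whose `a`-exponents are
  `≤ E` has at most `2 (L E + 1)` Newton vertices in its `(0,2)` entry — for such words the absolute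
  subexponential bound behind S2 holds outright, with room to spare, as long as `E ≤ 2^{L^ε}/L`;
  any counterexample family to S2 needs exponents beyond `2^{L^ε}` for some fixed `ε > 0`.

Pure Mathlib (`extremePoints_convexHull_subset`, `openSegment_eq_image`,
`MvPolynomial.monomial_le_degreeOf`, `MvPolynomial.degreeOf_add_le/mul_le/C/X_self_pow/X_pow_of_ne`,
`Matrix.transvection_mul_apply_same/of_ne`) plus the definition `newtonVertexCount` of the tree
(`Literature/Computability/AlgebraicComplexity/NewtonPolygonTau.lean`).
-/

-- `Summit.ValiantsHypothesis.ValiantsHypothesis.…` is the tree's mandated single-conjunct layout.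
set_option linter.dupNamespace false

namespace Summit.ValiantsHypothesis.ValiantsHypothesis.Theorems.ElementaryWordLengthWordPerSuperPoly

open MvPolynomial Literature.Computability.AlgebraicComplexity

namespace DegreeBound

/-- Three points of the plane on one vertical line, ordered by height: the middle one lies in the
open segment of the outer two. [folklore] -/
theorem mem_openSegment_of_fst_eq {p q r : Fin 2 → ℝ} (hpq0 : p 0 = q 0) (hqr0 : q 0 = r 0)
    (hpq : p 1 < q 1) (hqr : q 1 < r 1) : q ∈ openSegment ℝ p r := by
  rw [openSegment_eq_image]
  have hrp : 0 < r 1 - p 1 := by linarith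
  refine ⟨(q 1 - p 1) / (r 1 - p 1), ⟨div_pos (by linarith) hrp, ?_⟩, ?_⟩
  · rw [div_lt_one hrp]; linarith
  · funext i
    fin_cases i
    · simp only [Fin.zero_eta, Fin.isValue, Pi.add_apply, Pi.smul_apply, smul_eq_mul]
      rw [hpq0, ← hqr0]; ring
    · simp only [Fin.mk_one, Fin.isValue, Pi.add_apply, Pi.smul_apply, smul_eq_mul]
      field_simp
      ring

/-- A vertical line carries no three extreme points of `conv T`: if `p, r ∈ T` and `q` lie on one
vertical line with `q` strictly between `p` and `r` in height, then `q` is not an extreme point of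
`conv T`. [folklore] -/
theorem not_mem_extremePoints_of_between {T : Set (Fin 2 → ℝ)} {p q r : Fin 2 → ℝ}
    (hp : p ∈ T) (hr : r ∈ T) (hpq0 : p 0 = q 0) (hqr0 : q 0 = r 0) (hpq : p 1 < q 1)
    (hqr : q 1 < r 1) : q ∉ (convexHull ℝ T).extremePoints ℝ := by
  intro hq
  rw [mem_extremePoints] at hq
  have h := hq.2 p (subset_convexHull ℝ T hp) r (subset_convexHull ℝ T hr)
    (mem_openSegment_of_fst_eq hpq0 hqr0 hpq hqr)
  have : p 1 = q 1 := by rw [h.1]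
  exact absurd this (ne_of_lt hpq)

/-- Two points of the plane with equal coordinates are equal. [folklore] -/
theorem eq_of_apply_eq {p q : Fin 2 → ℝ} (h0 : p 0 = q 0) (h1 : p 1 = q 1) : p = q := by
  funext i
  fin_cases i
  · exact h0
  · exact h1

/-- **At most two hull vertices per vertical line.** If every point of a plane set `T` has first
coordinate in `{0, 1, …, d}`, then `conv T` has at most `2 (d + 1)` extreme points: the map
`vertex ↦ (first coordinate, [some vertex lies strictly below it on the same vertical])` is
injective (three vertices on a vertical line are impossible) into a set of size `2 (d + 1)`.
[folklore] -/
theorem ncard_extremePoints_le_of_fst_le {T : Set (Fin 2 → ℝ)} (d : ℕ)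
    (hT : ∀ p ∈ T, ∃ n : ℕ, n ≤ d ∧ p 0 = n) :
    ((convexHull ℝ T).extremePoints ℝ).ncard ≤ 2 * (d + 1) := by
  classical
  set E : Set (Fin 2 → ℝ) := (convexHull ℝ T).extremePoints ℝ with hE
  have hET : E ⊆ T := extremePoints_convexHull_subset
  -- the target: (casts of `0..d`) × Bool, of size `(d+1) · 2`
  set tgt : Finset (ℝ × Bool) :=
    ((Finset.range (d + 1)).image (fun n : ℕ => (n : ℝ))) ×ˢ (Finset.univ : Finset Bool) with htgt
  have htgt_card : tgt.card = 2 * (d + 1) := by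
    rw [htgt, Finset.card_product, Finset.card_image_of_injective _ Nat.cast_injective,
      Finset.card_range, Finset.card_univ, Fintype.card_bool]
    ring
  -- the map
  let F : (Fin 2 → ℝ) → ℝ × Bool := fun p => (p 0, decide (∃ q ∈ E, q 0 = p 0 ∧ q 1 < p 1))
  have hF : ∀ p ∈ E, F p ∈ (tgt : Set (ℝ × Bool)) := by
    intro p hp
    obtain ⟨n, hn, hpn⟩ := hT p (hET hp)
    simp only [htgt, Finset.coe_product, Finset.coe_image, Finset.coe_range, Finset.coe_univ,
      Set.mem_prod, Set.mem_image, Set.mem_Iio, Set.mem_univ, and_true, F]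
    exact ⟨n, Nat.lt_succ_of_le hn, hpn.symm⟩
  have hinj : Set.InjOn F E := by
    intro p hp p' hp' hFp
    simp only [F, Prod.mk.injEq, decide_eq_decide] at hFp
    obtain ⟨h0, hiff⟩ := hFp
    by_contra hne
    have h1 : p 1 ≠ p' 1 := fun h1 => hne (eq_of_apply_eq h0 h1)
    rcases lt_or_gt_of_ne h1 with hlt | hgt
    · -- `p` lies strictly below `p'`, so `p'` is "upper"; hence so is `p`: a third vertex `q` below `p`
      obtain ⟨q, hq, hq0, hq1⟩ := hiff.2 ⟨p, hp, h0, hlt⟩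
      exact not_mem_extremePoints_of_between (hET hq) (hET hp') hq0 h0 hq1 hlt hp
    · obtain ⟨q, hq, hq0, hq1⟩ := hiff.1 ⟨p', hp', h0.symm, hgt⟩
      exact not_mem_extremePoints_of_between (hET hq) (hET hp) hq0 h0.symm hq1 hgt hp'
  calc E.ncard ≤ (tgt : Set (ℝ × Bool)).ncard :=
        Set.ncard_le_ncard_of_injOn F hF hinj (Finset.finite_toSet tgt)
    _ = 2 * (d + 1) := by rw [Set.ncard_coe_finset, htgt_card]

end DegreeBound

open DegreeBound

/-- **Newton vertices are bounded by the degree.** The Newton polygon of a bivariate polynomial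
`f` has at most `2 (deg_X f + 1)` vertices: every vertex is the image of an exponent `e` in the
support, whose first coordinate `e 0 ≤ degreeOf 0 f`, and a vertical line carries at most two
vertices. (Andrews' `O(N^{2/3})` for lattice polygons in `[0,N]²` is sharper; this linear bound is
all the line needs.) [folklore] -/
theorem newtonVertexCount_le_degreeOf {k : Type*} [CommSemiring k] (f : MvPolynomial (Fin 2) k) :
    newtonVertexCount f ≤ 2 * (f.degreeOf 0 + 1) := by
  apply ncard_extremePoints_le_of_fst_le
  rintro p ⟨e, he, rfl⟩
  exact ⟨e 0, monomial_le_degreeOf 0 (Finset.mem_coe.1 he), rfl⟩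

namespace DegreeBound

/-- The `X`-degree of a sparse letter's polynomial `c · X^a Y^b` is at most `a`. [folklore] -/
theorem degreeOf_letter_le (c : ℂ) (a b : ℕ) :
    degreeOf 0 (C c * (X 0 ^ a * X 1 ^ b) : MvPolynomial (Fin 2) ℂ) ≤ a := by
  calc degreeOf 0 (C c * (X 0 ^ a * X 1 ^ b) : MvPolynomial (Fin 2) ℂ)
      ≤ degreeOf 0 (X 0 ^ a * X 1 ^ b : MvPolynomial (Fin 2) ℂ) := degreeOf_C_mul_le _ _ _
    _ ≤ degreeOf 0 (X 0 ^ a : MvPolynomial (Fin 2) ℂ) + degreeOf 0 (X 1 ^ b : MvPolynomial (Fin 2) ℂ) :=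
        degreeOf_mul_le _ _ _
    _ = a := by
        rw [degreeOf_X_self_pow, degreeOf_X_pow_of_ne _ (by decide : (0 : Fin 2) ≠ 1), add_zero]

/-- **Entries of a word matrix have small `X`-degree.** Every entry of the matrix of a sparse
bivariate word (letters `(i, j, c, (a, b)) ↦ E_{ij}(c · X^a Y^b)`) has `X`-degree at most the sum of
the `a`-exponents of the letters: left-multiplying by `E_{ij}(t)` replaces row `i` by
`row i + t · row j` and leaves the other rows alone. [folklore] -/
theorem degreeOf_wordProd_le : ∀ (w : List (Fin 3 × Fin 3 × ℂ × (ℕ × ℕ))) (r s : Fin 3),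
    degreeOf 0 ((w.map (fun l : Fin 3 × Fin 3 × ℂ × (ℕ × ℕ) => Matrix.transvection l.1 l.2.1
      (MvPolynomial.C l.2.2.1 * (MvPolynomial.X 0 ^ l.2.2.2.1 * MvPolynomial.X 1 ^ l.2.2.2.2) :
        MvPolynomial (Fin 2) ℂ))).prod r s) ≤ (w.map (fun l => l.2.2.2.1)).sum
  | [], r, s => by
      rw [List.map_nil, List.prod_nil, List.map_nil, List.sum_nil, Matrix.one_apply]
      split_ifs
      · rw [degreeOf_one]
      · rw [degreeOf_zero]
  | l :: w, r, s => by
      rw [List.map_cons, List.prod_cons, List.map_cons, List.sum_cons]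
      set N := (w.map (fun l : Fin 3 × Fin 3 × ℂ × (ℕ × ℕ) => Matrix.transvection l.1 l.2.1
        (MvPolynomial.C l.2.2.1 * (MvPolynomial.X 0 ^ l.2.2.2.1 * MvPolynomial.X 1 ^ l.2.2.2.2) :
          MvPolynomial (Fin 2) ℂ))).prod with hN
      have ih : ∀ r' s', degreeOf 0 (N r' s') ≤ (w.map (fun l => l.2.2.2.1)).sum :=
        fun r' s' => degreeOf_wordProd_le w r' s'
      by_cases hr : r = l.1
      · subst hr
        rw [Matrix.transvection_mul_apply_same]
        calc degreeOf 0 (N l.1 s + C l.2.2.1 * (X 0 ^ l.2.2.2.1 * X 1 ^ l.2.2.2.2) * N l.2.1 s)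
            ≤ max (degreeOf 0 (N l.1 s))
                (degreeOf 0 (C l.2.2.1 * (X 0 ^ l.2.2.2.1 * X 1 ^ l.2.2.2.2) * N l.2.1 s)) :=
              degreeOf_add_le _ _ _
          _ ≤ l.2.2.2.1 + (w.map (fun l => l.2.2.2.1)).sum := by
              apply max_le
              · exact le_trans (ih _ _) (Nat.le_add_left _ _)
              · calc degreeOf 0 (C l.2.2.1 * (X 0 ^ l.2.2.2.1 * X 1 ^ l.2.2.2.2) * N l.2.1 s)
                    ≤ degreeOf 0 (C l.2.2.1 * (X 0 ^ l.2.2.2.1 * X 1 ^ l.2.2.2.2) :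
                        MvPolynomial (Fin 2) ℂ) + degreeOf 0 (N l.2.1 s) := degreeOf_mul_le _ _ _
                  _ ≤ l.2.2.2.1 + (w.map (fun l => l.2.2.2.1)).sum :=
                        Nat.add_le_add (degreeOf_letter_le _ _ _) (ih _ _)
      · rw [Matrix.transvection_mul_apply_of_ne (ha := hr)]
        exact le_trans (ih r s) (Nat.le_add_left _ _)

/-- The sum of the `a`-exponents of a word whose `a`-exponents are `≤ E` is `≤ L · E`. [folklore] -/
theorem sum_exponents_le (E : ℕ) : ∀ (w : List (Fin 3 × Fin 3 × ℂ × (ℕ × ℕ))),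
    (∀ l ∈ w, l.2.2.2.1 ≤ E) → (w.map (fun l => l.2.2.2.1)).sum ≤ w.length * E
  | [], _ => by simp
  | l :: w, h => by
      rw [List.map_cons, List.sum_cons, List.length_cons]
      have h1 : l.2.2.2.1 ≤ E := h l (by simp)
      have h2 := sum_exponents_le E w (fun l' hl' => h l' (List.mem_cons_of_mem _ hl'))
      nlinarith

end DegreeBound

/-- **S2's absolute form in the exponent-bounded regime.** A sparse bivariate word of length `L`
whose letters `E_{ij}(c · X^a Y^b)` have `a ≤ E` has at most `2 (L E + 1)` vertices in the Newton
polygon of its `(0,2)` entry — whatever the coefficients and however much cancellation occurs.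
Consequently any family of words witnessing super-polynomially (let alone `2^{L^δ}`) many Newton
vertices must use exponents super-polynomial (resp. beyond `2^{L^δ}/L`) in the length. [folklore] -/
theorem newtonVertexCount_wordProd_le_of_exponents_le :
    ∀ (E : ℕ) (w : List (Fin 3 × Fin 3 × ℂ × (ℕ × ℕ))), (∀ l ∈ w, l.2.2.2.1 ≤ E) →
      newtonVertexCount
        ((w.map (fun l : Fin 3 × Fin 3 × ℂ × (ℕ × ℕ) => Matrix.transvection l.1 l.2.1
          (MvPolynomial.C l.2.2.1 * (MvPolynomial.X 0 ^ l.2.2.2.1 * MvPolynomial.X 1 ^ l.2.2.2.2) :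
            MvPolynomial (Fin 2) ℂ))).prod 0 2) ≤ 2 * (w.length * E + 1) := by
  intro E w hE
  calc _ ≤ 2 * (degreeOf 0 ((w.map (fun l : Fin 3 × Fin 3 × ℂ × (ℕ × ℕ) =>
          Matrix.transvection l.1 l.2.1 (MvPolynomial.C l.2.2.1 *
            (MvPolynomial.X 0 ^ l.2.2.2.1 * MvPolynomial.X 1 ^ l.2.2.2.2) :
              MvPolynomial (Fin 2) ℂ))).prod 0 2) + 1) := newtonVertexCount_le_degreeOf _
    _ ≤ 2 * ((w.map (fun l => l.2.2.2.1)).sum + 1) :=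
        Nat.mul_le_mul_left 2 (Nat.add_le_add_right (degreeOf_wordProd_le w 0 2) 1)
    _ ≤ 2 * (w.length * E + 1) :=
        Nat.mul_le_mul_left 2 (Nat.add_le_add_right (sum_exponents_le E w hE) 1)

end Summit.ValiantsHypothesis.ValiantsHypothesis.Theorems.ElementaryWordLengthWordPerSuperPoly
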